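import Literature.NumberTheory.Transcendental.RoySmallValueGainVeronese
import Literature.NumberTheory.Transcendental.RoySmallValueLevelHeights
import Literature.NumberTheory.Transcendental.RoySmallValueDescentK
import HarnessLib

/-!
# Roy's small value estimate for `𝔾ₐ × 𝔾ₘ` — the sup-normalised leading constant of a level package is large

Topic `Literature/NumberTheory/Transcendental`. Part of the formalisation of the proof of Roy 2013,
Theorem 1.1 (named fact `roy2013_thm_1_1`, `RoySmallValueEstimates.lean`), seat B. Source: D. Roy,
*A small value estimate for `𝔾ₐ × 𝔾ₘ`*, Mathematika 59 (2013) 333–363 = arXiv:1301.0663,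
Proposition 2.3 (p. 7) and §6, (6.5), and the role of `log|a|` in Propositions 2.4, 6.2 (pp. 7, 16):

> `F(P) = a ∏_{α∈Z} P(α)` [...] where the points are normalized to have norm `1` [...]
> `|log|a| − D h(Z)| ≤ 7 log(m+1) D deg(Z)` [...] As `log|a| ≥ 0`, the conclusion follows.

For a level package `L : LevelPkg D P̃` (parallel seat's `RoySmallValueLevels`: pivot-normalised
representatives `α_j`, `Φ(P̃, Q, ·) = c ∏_j ℓ_{α_j}^{e_j}` over `ℂ`) and a normal number field
`K ⊂ ℂ` containing the coordinates, write `a_sup := |c| ∏_j ‖α_j‖^{D e_j}` for the leading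
constant with respect to the SUP-normalised representatives `u_j = α_j/‖α_j‖` (so that
`Φ(P̃, Q, R) = ± a_sup ∏_j R(u_j)^{e_j}` in modulus). We prove Roy's `log|a| ≥ D h(Z)` in the form

  `(D/[K:ℚ]) ∑_j e_j h_K(rep j) ≤ log|c| + D ∑_j e_j log ‖α_j‖`      (`height_le_log_leading_sup`)

(constant `7 log(m+1) D deg Z` improved to `0`), from `sum_mul_height_le_sum_emb_veronese`
(`RoySmallValueGainVeronese`), the `K`-factorisation and Galois bookkeeping of
`RoySmallValueDescentK` (`σ A = c` for all embeddings, `e` constant on orbits) and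
`RoySmallValueOrbitsK` (embeddings ↔ automorphisms). In particular `a_sup ≥ 1`
(`one_le_leading_sup`). Everything is proved; no definitions, no named facts.

## References

* [Roy2013] D. Roy, *A small value estimate for 𝔾ₐ × 𝔾ₘ*, Mathematika 59 (2013), 333–363
  (arXiv:1301.0663), Proposition 2.3, §6 (6.5), and Propositions 2.4, 6.2 (use of `log|a| ≥ 0`).
-/

noncomputable section

open MvPolynomial NumberField Height Finset

namespace Literature.NumberTheory.Transcendental

namespace Roy2013

namespace LevelPkg

variable {D : ℕ} {Pt : MvPolynomial (Fin 3) ℤ} (L : LevelPkg D Pt) (K : IntermediateField ℚ ℂ)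
  (hK : ∀ i k, L.α i k ∈ K)

/-- The complex factorisation of `F₀ = intF` in `ZeroConfigK` form. [folklore] -/
theorem map_intF_eq_prod_cfg :
    map (Int.castRingHom ℂ) L.intF = C L.c * ∏ i, evalForm D ((L.cfg K hK).α i) ^ L.e i := by
  rw [map_intF, cfg_α]; exact L.hFeq

/-- Exact multiplicities, in `ZeroConfigK` form. [folklore] -/
theorem hemax_cfg (i : Fin L.m) (k : ℕ)
    (h : evalForm D ((L.cfg K hK).α i) ^ k ∣ map (Int.castRingHom ℂ) L.intF) : k ≤ L.e i := by
  rw [map_intF, cfg_α] at h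
  exact L.hemax i k h

/-- **Roy's `log|a| ≥ D h(Z)` for the sup-normalised leading constant of a level package**:
`(D/[K:ℚ]) ∑_j e_j h_K(rep j) ≤ log|c| + D ∑_j e_j log‖α_j‖`, stated multiplied by `[K:ℚ]`.
[cite: Roy2013, Proposition 2.3 and §6 (6.5)] -/
theorem height_le_log_leading_sup [Normal ℚ K] [NumberField K] :
    ∑ j, (L.e j : ℝ) * (D * logHeight ((L.cfg K hK).rep j)) ≤
      Module.finrank ℚ K * (Real.log ‖L.c‖ + D * ∑ j, (L.e j : ℝ) * Real.log ‖L.α j‖) := by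
  classical
  set Z := L.cfg K hK with hZ
  -- the factorisation over `K`
  obtain ⟨A, hA, hfacK⟩ := exists_factorisation_fld Z (L.map_intF_eq_prod_cfg K hK)
  have h := sum_mul_height_le_sum_emb_veronese L.intF_ne_zero (fun j => Z.rep_ne_zero j) hfacK
  refine h.trans (le_of_eq ?_)
  -- `σ A = c` and `‖σ ∘ rep j‖ = ‖α (perm g j)‖`
  have hσA : ∀ σ : K →+* ℂ, ‖σ A‖ = ‖L.c‖ := by
    intro σ
    rw [← ZeroConfigK.coe_autOfEmb σ A,
      coe_algEquiv_leading_eq Z (L.map_intF_eq_prod_cfg K hK) (L.hemax_cfg K hK) hfacK]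
  have hσrep : ∀ (σ : K →+* ℂ) j, ‖(σ ∘ Z.rep j : Fin 3 → ℂ)‖ =
      ‖L.α (Z.perm (ZeroConfigK.autOfEmb σ) j)‖ := by
    intro σ j
    rw [Z.emb_comp_rep σ j]; rfl
  simp_rw [hσA, hσrep]
  -- sum over embeddings = sum over automorphisms, then re-index each by `perm g`
  have hinner : ∀ g : K ≃ₐ[ℚ] K, ∑ j, (L.e j : ℝ) * Real.log ‖L.α (Z.perm g j)‖ =
      ∑ j, (L.e j : ℝ) * Real.log ‖L.α j‖ := by
    intro g
    have h1 : ∀ j, (L.e j : ℝ) * Real.log ‖L.α (Z.perm g j)‖ =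
        (L.e (Z.perm g j) : ℝ) * Real.log ‖L.α (Z.perm g j)‖ := fun j => by
      rw [mult_perm Z (L.map_intF_eq_prod_cfg K hK) (L.hemax_cfg K hK) g j]
    simp_rw [h1]
    exact Equiv.sum_comp (Z.permEquiv g) (fun j => (L.e j : ℝ) * Real.log ‖L.α j‖)
  rw [Finset.sum_add_distrib, Finset.sum_const, card_univ, nsmul_eq_mul,
    ZeroConfigK.sum_emb_eq_sum_aut (fun g => (D : ℝ) * ∑ j, (L.e j : ℝ) * Real.log ‖L.α (Z.perm g j)‖)]
  simp_rw [hinner]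
  rw [Finset.sum_const, card_univ, nsmul_eq_mul, ZeroConfigK.card_aut_eq_finrank K,
    NumberField.Embeddings.card]
  ring

/-- **`a_sup ≥ 1`**: `0 ≤ log|c| + D ∑_j e_j log‖α_j‖` (heights are non-negative).
[cite: Roy2013, Proposition 2.4 (proof: "As `log|a| ≥ 0`")] -/
theorem log_leading_sup_nonneg [Normal ℚ K] [NumberField K] (hK : ∀ i k, L.α i k ∈ K) :
    0 ≤ Real.log ‖L.c‖ + D * ∑ j, (L.e j : ℝ) * Real.log ‖L.α j‖ := by
  have h := L.height_le_log_leading_sup K hK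
  have hn : (0 : ℝ) < Module.finrank ℚ K := by exact_mod_cast Module.finrank_pos
  have h0 : 0 ≤ ∑ j, (L.e j : ℝ) * (D * logHeight ((L.cfg K hK).rep j)) :=
    Finset.sum_nonneg fun j _ => mul_nonneg (Nat.cast_nonneg _)
      (mul_nonneg (Nat.cast_nonneg _) (logHeight_nonneg _))
  nlinarith

end LevelPkg

end Roy2013

end Literature.NumberTheory.Transcendental
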